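import Literature.AlgebraicTopology.SingularHomology.FiniteDeckTransferProjectionFormula
import HarnessLib

/-!
# The transfer of a finite regular covering, IV: trace pairings and the adjoint of `τ^* ∘ q^*`

Complements to `FiniteDeckTransferProjectionFormula` (A. Hatcher, *Algebraic Topology* (2002), §3.G
p. 321: the transfer `τ^*` of a finite regular covering; part III: the projection formula
`τ^*(p^* a ⌣ b) = a ⌣ τ^* b`, `τ^*(b ⌣ p^* a) = τ^* b ⌣ a`).  For a finite regular covering
`c : FiniteDeckCover G E B` with projection `p`, a commutative ring `R`, and TRACE functionals
`t_B : Hᵗ(B; R) → R`, `t_E : Hᵗ(E; R) → R` compatible with the transfer (`t_B ∘ τ^* = t_E` in degree `t`,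
the normalisation `∫_E = ∫_B ∘ τ^*` of a finite covering of closed oriented manifolds), consider the cup
pairings `⟨u, v⟩_B = t_B((u ⌣ v) ⌣ ℓ)`, `⟨x, y⟩_E = t_E((x ⌣ y) ⌣ p^* ℓ)` twisted by a class `ℓ ∈ Hˢ(B; R)`
(a power of a Kähler / polarization class).  Then:

* `FiniteDeckCover.pairing_transferMap_left` — **`⟨τ^* y, v⟩_B = ⟨y, p^* v⟩_E`** (`τ^*` is left adjoint to
  `p^*`: projection formula twice, then the trace compatibility);
* `FiniteDeckCover.pairing_transferMap_right` — **`⟨x, τ^* y⟩_B = ⟨p^* x, y⟩_E`**;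
* `FiniteDeckCover.pairing_transferMap_map_comm` — for TWO regular covering structures `c₁`, `c₂` on the
  same `E → B`-situation (projections `p₁`, `p₂`; e.g. the two legs of a symmetric correspondence) with
  `p₁^* ℓ = p₂^* ℓ` and both traces compatible: **`⟨τ₁^*(p₂^* x), v⟩_B = ⟨x, τ₂^*(p₁^* v)⟩_B`** — the operator
  `τ₂^* ∘ p₁^*` is the ADJOINT of the correspondence operator `τ₁^* ∘ p₂^*` for the pairing `⟨·,·⟩_B`
  (Shimura's `⟨T_{ΓgΓ} x, y⟩ = ⟨x, T_{Γg⁻¹Γ} y⟩` pattern, read through a common Galois level).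

Pure algebraic topology (no Hodge theory): this is the `hadj`-shaped input of the semisimplicity door
`Literature.AlgebraicGeometry.Motives.HodgeStructure.Polarization.isSemisimple_apply` for algebras of
correspondence operators, once the polarization is a cup pairing; written for the cell `pub-hodgecm2`
(count-neutral).  All proved; no named facts, no definitions, no instances.

## References

* [HatcherAT2002] A. Hatcher, Algebraic Topology, CUP 2002, §3.G p. 321 (transfer homomorphisms),
  Prop. 3.10 (naturality of the cup product).
* [Shimura1971] G. Shimura, Introduction to the Arithmetic Theory of Automorphic Functions (1971), §3.4
  (3.4.5) and §8.3 (action of double cosets on cohomology; adjointness for the Petersson product).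
-/

noncomputable section

open CategoryTheory

universe u v w w'

namespace Literature.AlgebraicTopology.SingularHomology

namespace FiniteDeckCover

variable {G : Type w} [Group G] [Fintype G] {E B : Type u} [TopologicalSpace E] [TopologicalSpace B]
  [MulAction G E] (c : FiniteDeckCover G E B) {R : Type v} [CommRing R] {k m s t : ℕ}

/-! ### `τ^*` and `p^*` are adjoint for trace pairings twisted by a pulled-back class -/

/-- **`⟨τ^* y, v⟩_B = ⟨y, p^* v⟩_E`**: for traces with `t_B ∘ τ^* = t_E` (degree `t`) and the pairings
`⟨u, v⟩_B = t_B((u ⌣ v) ⌣ ℓ)`, `⟨x, y⟩_E = t_E((x ⌣ y) ⌣ p^*ℓ)`: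
`t_B((τ^* y ⌣ v) ⌣ ℓ) = t_B(τ^*((y ⌣ p^* v) ⌣ p^* ℓ)) = t_E((y ⌣ p^* v) ⌣ p^* ℓ)` (projection formula on
the right, twice). [cite: HatcherAT2002, §3.G p. 321 and Prop. 3.10] -/
theorem pairing_transferMap_left (h1 : k + k = m) (h2 : m + s = t)
    (tB : singularCohomology R R B t →ₗ[R] R) (tE : singularCohomology R R E t →ₗ[R] R)
    (ht : ∀ z, tB (c.transferMap t z) = tE z) (ℓ : singularCohomology R R B s)
    (y : singularCohomology R R E k) (v : singularCohomology R R B k) :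
    tB (cupProduct h2 (cupProduct h1 (c.transferMap k y) v) ℓ) =
      tE (cupProduct h2 (cupProduct h1 y (singularCohomology.map R R c.proj k v))
        (singularCohomology.map R R c.proj s ℓ)) := by
  rw [← c.transferMap_cupProduct_map_right h1 y v, ← c.transferMap_cupProduct_map_right h2 _ ℓ, ht]

/-- **`⟨x, τ^* y⟩_B = ⟨p^* x, y⟩_E`**: `t_B((x ⌣ τ^* y) ⌣ ℓ) = t_B(τ^*((p^* x ⌣ y) ⌣ p^* ℓ)) =
t_E((p^* x ⌣ y) ⌣ p^* ℓ)` (projection formula on the left, then on the right).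
[cite: HatcherAT2002, §3.G p. 321 and Prop. 3.10] -/
theorem pairing_transferMap_right (h1 : k + k = m) (h2 : m + s = t)
    (tB : singularCohomology R R B t →ₗ[R] R) (tE : singularCohomology R R E t →ₗ[R] R)
    (ht : ∀ z, tB (c.transferMap t z) = tE z) (ℓ : singularCohomology R R B s)
    (x : singularCohomology R R B k) (y : singularCohomology R R E k) :
    tB (cupProduct h2 (cupProduct h1 x (c.transferMap k y)) ℓ) =
      tE (cupProduct h2 (cupProduct h1 (singularCohomology.map R R c.proj k x) y)
        (singularCohomology.map R R c.proj s ℓ)) := by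
  rw [← c.transferMap_cupProduct_map_left h1 x y, ← c.transferMap_cupProduct_map_right h2 _ ℓ, ht]

/-! ### The adjoint of a correspondence operator `τ₁^* ∘ p₂^*` is `τ₂^* ∘ p₁^*` -/

/-- **`⟨τ₁^*(p₂^* x), v⟩_B = ⟨x, τ₂^*(p₁^* v)⟩_B`.**  Let `c₁`, `c₂` be two finite regular covering
structures with the same total space `E` and base `B` (projections `p₁`, `p₂`, deck groups `G₁`, `G₂`),
let the traces satisfy `t_B ∘ τ₁^* = t_E = t_B ∘ τ₂^*` in degree `t`, and let `ℓ ∈ Hˢ(B; R)` satisfy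
`p₁^* ℓ = p₂^* ℓ`.  Then for the pairing `⟨u, v⟩_B = t_B((u ⌣ v) ⌣ ℓ)` the correspondence operators
`T = τ₁^* ∘ p₂^*` and `T' = τ₂^* ∘ p₁^*` on `Hᵏ(B; R)` are ADJOINT: both sides equal
`t_E((p₂^* x ⌣ p₁^* v) ⌣ p₁^* ℓ)` (`pairing_transferMap_left` for `c₁`, `pairing_transferMap_right` for
`c₂`).  This is the shape `⟨T_{ΓgΓ} x, y⟩ = ⟨x, T_{Γg⁻¹Γ} y⟩` of the adjointness of Hecke operators.
[cite: HatcherAT2002, §3.G p. 321 and Prop. 3.10] [cite: Shimura1971, §3.4 (3.4.5) and §8.3] -/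
theorem pairing_transferMap_map_comm {G₁ : Type w} [Group G₁] [Fintype G₁] [MulAction G₁ E]
    {G₂ : Type w'} [Group G₂] [Fintype G₂] [MulAction G₂ E]
    (c₁ : FiniteDeckCover G₁ E B) (c₂ : FiniteDeckCover G₂ E B) (h1 : k + k = m) (h2 : m + s = t)
    (tB : singularCohomology R R B t →ₗ[R] R) (tE : singularCohomology R R E t →ₗ[R] R)
    (ht₁ : ∀ z, tB (c₁.transferMap t z) = tE z) (ht₂ : ∀ z, tB (c₂.transferMap t z) = tE z)
    (ℓ : singularCohomology R R B s)
    (hℓ : singularCohomology.map R R c₁.proj s ℓ = singularCohomology.map R R c₂.proj s ℓ)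
    (x v : singularCohomology R R B k) :
    tB (cupProduct h2 (cupProduct h1
        (c₁.transferMap k (singularCohomology.map R R c₂.proj k x)) v) ℓ) =
      tB (cupProduct h2 (cupProduct h1 x
        (c₂.transferMap k (singularCohomology.map R R c₁.proj k v))) ℓ) := by
  rw [c₁.pairing_transferMap_left h1 h2 tB tE ht₁ ℓ, c₂.pairing_transferMap_right h1 h2 tB tE ht₂ ℓ, hℓ]

/-- **Adjoint-pair form.**  Under the hypotheses of `pairing_transferMap_map_comm`, with the `R`-bilinear
pairing `⟨u, v⟩_B = t_B((u ⌣ v) ⌣ ℓ)` written as `Φ u v`, the linear maps `T = τ₁^* ∘ p₂^*` and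
`T' = τ₂^* ∘ p₁^*` satisfy `Φ (T x) v = Φ x (T' v)` for all `x, v` — i.e. `(T, T')` is an adjoint pair for
`Φ` in the sense of `LinearMap.IsAdjointPair Φ Φ T T'`. [cite: HatcherAT2002, §3.G p. 321 and Prop. 3.10]
[cite: Shimura1971, §3.4 (3.4.5) and §8.3] -/
theorem isAdjointPair_transferMap_comp_map {G₁ : Type w} [Group G₁] [Fintype G₁] [MulAction G₁ E]
    {G₂ : Type w'} [Group G₂] [Fintype G₂] [MulAction G₂ E]
    (c₁ : FiniteDeckCover G₁ E B) (c₂ : FiniteDeckCover G₂ E B) (h1 : k + k = m) (h2 : m + s = t)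
    (tB : singularCohomology R R B t →ₗ[R] R) (tE : singularCohomology R R E t →ₗ[R] R)
    (ht₁ : ∀ z, tB (c₁.transferMap t z) = tE z) (ht₂ : ∀ z, tB (c₂.transferMap t z) = tE z)
    (ℓ : singularCohomology R R B s)
    (hℓ : singularCohomology.map R R c₁.proj s ℓ = singularCohomology.map R R c₂.proj s ℓ)
    (Φ : singularCohomology R R B k →ₗ[R] singularCohomology R R B k →ₗ[R] R)
    (hΦ : ∀ u v, Φ u v = tB (cupProduct h2 (cupProduct h1 u v) ℓ)) :
    LinearMap.IsAdjointPair Φ Φ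
      ((c₁.transferMap k).hom ∘ₗ (singularCohomology.map R R c₂.proj k).hom)
      ((c₂.transferMap k).hom ∘ₗ (singularCohomology.map R R c₁.proj k).hom) := by
  intro x v
  rw [LinearMap.comp_apply, LinearMap.comp_apply, hΦ, hΦ]
  exact pairing_transferMap_map_comm c₁ c₂ h1 h2 tB tE ht₁ ht₂ ℓ hℓ x v

end FiniteDeckCover

end Literature.AlgebraicTopology.SingularHomology

end
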